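import Summits.CriticalPhenomena.PercolationContinuityZ3.Theorems.PercNearOneGluingNoHeavyConstsUnconditionalChainRule
import HarnessLib
import HarnessLib.Audit.Tags

/-!
# Single-edge Bernstein positivity of the reverse-regularity gap (PAPER-2 track (ii), constants of the CSH family)

builds on p205010 (kernel theorem, internal audit signed; external expert review pending).  Support file (`--supports
stmt-CriticalPhenomena-4575`), seat `prim-consts-2` (gen 5); rows A6/A11 of `run/shared/lean/prim/consts/CONSTANTS.md`; memo
`run/shared/lean/prim/consts/FROM-prim-consts-2-g5-EDGE-BERNSTEIN.md`.  No definitions, no sorries; standard axioms.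

Notation: `μ = prodBernoulli w` on a finite vertex type, `K(S,T) = μ{S ↮ T}` (no open path between the vertex sets `S` and `T`;
the symmetric, antitone "disconnection kernel" of `…ConstsSingleEdgeDisconnection.lean`).  For a source set `X`, vertices `z, u`
and targets `T₁ ⊆ T₂`, van den Berg–Häggström–Kahn reverse regularity (`Consts.disconnect_rr2`) says that the gap
`g(X) := K(X,T₂)K(Xu,T₁) − K(X,T₁)K(Xu,T₂)` is `≥ 0`.  Seen as a function of the weight `t` of ONE edge `e = x'z` at the source
(`x' ∈ X`, `z ∉ X`), every entry interpolates linearly between the graph without `e` and the graph with `z` merged into the source,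
`K_t(S,T) = (1 − t)·K(S,T) + t·K(S ∪ {z},T)` (`S ∋ x'`, kernel of the graph without `e` on the right), so `g` is a quadratic in `t`
whose Bernstein coefficients are `g(X)`, `g(X ∪ {z})` and the MIXED coefficient

  `g₁ = [K(Xz,T₂)K(Xu,T₁) − K(Xz,T₁)K(Xu,T₂)] + [K(X,T₂)K(Xzu,T₁) − K(X,T₁)K(Xzu,T₂)]`.

The second bracket is a reverse-regularity gap (`X ⊆ Xzu`), the first compares the INCOMPARABLE sources `Xz`, `Xu` and has both
signs (exact numerics: negative in 35 of 116 random instances).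

* `Consts.real_avoid_insert_mul_le` — log-supermodularity of `K(·,T)` in the source: `K(Xa,T)·K(Xb,T) ≤ K(X,T)·K(Xab,T)`
  (vdBHK Thm 1.3 with sets for the cluster of `T` given `T ↮ X`: the decreasing events `{a ∉ C_T}`, `{b ∉ C_T}` are positively
  correlated).
* `Consts.rr2_edgeBernstein` — **THEOREM `g₁ ≥ 0`**: the reverse-regularity gap is Bernstein-positive in every single source-edge
  weight.  Proof: the polynomial identity
  `K(Xu,T₁)K(Xzu,T₁)·g₁ = K(Xu,T₁)²·H₂ + K(Xzu,T₁)²·H₁ + [K(X,T₁)K(Xzu,T₁) − K(Xz,T₁)K(Xu,T₁)]·H₄`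
  with the three reverse-regularity gaps `H₁ = g(X)`, `H₂ = g(Xz)`, `H₄ = K(Xu,T₂)K(Xzu,T₁) − K(Xu,T₁)K(Xzu,T₂)` (`Xu ⊆ Xzu`) and the
  log-supermodularity bracket, all `≥ 0`; the degenerate case `K(Xu,T₁)K(Xzu,T₁) = 0` is settled by monotonicity.

This is the order-2 instance of the "edge-Bernstein" programme for the single-edge chain rule (`Consts.SingleEdgeChainRule`):
the analogous statement for the `3 × 3` chain-rule determinant (conjecture `EB`, memo §2) is exactly the inductive step of an
induction on the number of edges that would prove the chain rule, and is implied by the Bernstein-positivity conjecture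
`Consts.ChainRuleBernstein`; the present theorem proves the weakest nontrivial (annealed, single-edge) shadow of the gen-4
"quenched reverse regularity" conjecture Q1.
[cite: VandenbergHaggstromKahn2005, Thm. 1.3 (p. 6), Thm. 1.5 (p. 7), Thm. 2.1 (p. 9), Remark 1 after Thm. 1.2 (p. 5)]
-/

noncomputable section

namespace Summit.CriticalPhenomena.PercolationContinuityZ3.Theorems

open MeasureTheory Set Literature.Probability.LatticeModels Literature.Probability.Percolation
open scoped Classical

namespace Consts

variable {V : Type*} [Fintype V]

/-- **Log-supermodularity of the disconnection kernel in the source.**  For vertex sets `X, T` and vertices `a, b`: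
`K(Xa,T) · K(Xb,T) ≤ K(X,T) · K(Xab,T)` (`K(S,T) = μ{S ↮ T}`, `Xa = X ∪ {a}`), i.e. given `T ↮ X` the decreasing cluster events
`{a ∉ C_T}` and `{b ∉ C_T}` are positively correlated — van den Berg–Häggström–Kahn's Theorem 1.3 with a source set.
[cite: VandenbergHaggstromKahn2005, Thm. 1.3 (p. 6) with Remark 1 after Thm. 1.2 (p. 5)] -/
theorem real_avoid_insert_mul_le (w : Sym2 V → unitInterval) (X T : Set V) (a b : V) :
    (prodBernoulli w).real {ω : BondConfig V | ∀ s ∈ insert a X, ∀ t ∈ T, ¬ (openGraph ω).Reachable s t} *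
        (prodBernoulli w).real {ω : BondConfig V | ∀ s ∈ insert b X, ∀ t ∈ T, ¬ (openGraph ω).Reachable s t} ≤
      (prodBernoulli w).real {ω : BondConfig V | ∀ s ∈ X, ∀ t ∈ T, ¬ (openGraph ω).Reachable s t} *
        (prodBernoulli w).real {ω : BondConfig V | ∀ s ∈ insert b (insert a X), ∀ t ∈ T,
          ¬ (openGraph ω).Reachable s t} := by
  classical
  set μ := prodBernoulli w with hμ
  have hmeas : ∀ U : Set (BondConfig V), MeasurableSet U := fun _ => MeasurableSet.of_discrete
  -- the cluster of the source set `T` avoiding `X`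
  set D : Set (BondConfig V) := {ω | ∀ s ∈ T, ∀ t ∈ X, ¬ (openGraph ω).Reachable s t} with hD
  set E₁ : Set (BondConfig V) := {ω | ∃ s ∈ T, ∃ c ∈ ({a} : Set V), (openGraph ω).Reachable s c} with hE₁
  set E₂ : Set (BondConfig V) := {ω | ∃ s ∈ T, ∃ c ∈ ({b} : Set V), (openGraph ω).Reachable s c} with hE₂
  have key := real_avoid_conn_mul_conn_le w T X (subset_refl T) (subset_refl T) ({a} : Set V) ({b} : Set V)
  -- key : μ.real (D ∩ E₁) * μ.real (D ∩ E₂) ≤ μ.real D * μ.real (D ∩ (E₁ ∩ E₂))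
  -- set identities
  have hX : {ω : BondConfig V | ∀ s ∈ X, ∀ t ∈ T, ¬ (openGraph ω).Reachable s t} = D := by
    rw [hD]; exact setOf_avoid_comm X T
  have hXa : {ω : BondConfig V | ∀ s ∈ insert a X, ∀ t ∈ T, ¬ (openGraph ω).Reachable s t} = D \ E₁ := by
    ext ω
    simp only [hD, hE₁, mem_setOf_eq, mem_sdiff, mem_insert_iff, mem_singleton_iff, not_exists, not_and]
    constructor
    · intro h
      exact ⟨fun s hs t ht hst => h t (Or.inr ht) s hs hst.symm, fun s hs c hc hsc => by
        subst hc; exact h c (Or.inl rfl) s hs hsc.symm⟩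
    · rintro ⟨h1, h2⟩ s hs t ht hst
      rcases hs with rfl | hs
      · exact h2 t ht s rfl hst.symm
      · exact h1 t ht s hs hst.symm
  have hXb : {ω : BondConfig V | ∀ s ∈ insert b X, ∀ t ∈ T, ¬ (openGraph ω).Reachable s t} = D \ E₂ := by
    ext ω
    simp only [hD, hE₂, mem_setOf_eq, mem_sdiff, mem_insert_iff, mem_singleton_iff, not_exists, not_and]
    constructor
    · intro h
      exact ⟨fun s hs t ht hst => h t (Or.inr ht) s hs hst.symm, fun s hs c hc hsc => by
        subst hc; exact h c (Or.inl rfl) s hs hsc.symm⟩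
    · rintro ⟨h1, h2⟩ s hs t ht hst
      rcases hs with rfl | hs
      · exact h2 t ht s rfl hst.symm
      · exact h1 t ht s hs hst.symm
  have hXab : {ω : BondConfig V | ∀ s ∈ insert b (insert a X), ∀ t ∈ T, ¬ (openGraph ω).Reachable s t} =
      (D \ E₁) \ E₂ := by
    ext ω
    simp only [hD, hE₁, hE₂, mem_setOf_eq, mem_sdiff, mem_insert_iff, mem_singleton_iff, not_exists, not_and]
    constructor
    · intro h
      refine ⟨⟨fun s hs t ht hst => h t (Or.inr (Or.inr ht)) s hs hst.symm, fun s hs c hc hsc => by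
        subst hc; exact h c (Or.inr (Or.inl rfl)) s hs hsc.symm⟩, fun s hs c hc hsc => by
        subst hc; exact h c (Or.inl rfl) s hs hsc.symm⟩
    · rintro ⟨⟨h1, h2⟩, h3⟩ s hs t ht hst
      rcases hs with rfl | rfl | hs
      · exact h3 t ht s rfl hst.symm
      · exact h2 t ht s rfl hst.symm
      · exact h1 t ht s hs hst.symm
  rw [hX, hXa, hXb, hXab]
  -- measure arithmetic: complements inside `D`
  have e1 : μ.real (D \ E₁) = μ.real D - μ.real (D ∩ E₁) := by
    have h := measureReal_inter_add_sdiff (μ := μ) (s := D) (hmeas E₁); linarith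
  have e2 : μ.real (D \ E₂) = μ.real D - μ.real (D ∩ E₂) := by
    have h := measureReal_inter_add_sdiff (μ := μ) (s := D) (hmeas E₂); linarith
  have e12 : μ.real ((D \ E₁) \ E₂) = μ.real D - μ.real (D ∩ E₁) - μ.real (D ∩ E₂) + μ.real (D ∩ (E₁ ∩ E₂)) := by
    have h := measureReal_inter_add_sdiff (μ := μ) (s := D \ E₁) (hmeas E₂)
    have h' := measureReal_inter_add_sdiff (μ := μ) (s := D ∩ E₂) (hmeas E₁)
    have hset1 : (D \ E₁) ∩ E₂ = (D ∩ E₂) \ E₁ := by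
      ext ω; simp only [mem_inter_iff, mem_sdiff]; tauto
    have hset2 : (D ∩ E₂) ∩ E₁ = D ∩ (E₁ ∩ E₂) := by
      ext ω; simp only [mem_inter_iff]; tauto
    rw [hset1] at h
    rw [hset2] at h'
    linarith
  rw [e1, e2, e12]
  nlinarith [key, measureReal_nonneg (μ := μ) (s := D), measureReal_nonneg (μ := μ) (s := D ∩ E₁),
    measureReal_nonneg (μ := μ) (s := D ∩ E₂), measureReal_nonneg (μ := μ) (s := D ∩ (E₁ ∩ E₂))]

/-- **THEOREM — the reverse-regularity gap is single-edge Bernstein positive.**  For every finite weighted graph, a source set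
`X`, vertices `z, u` and targets `T₁ ⊆ T₂` (`K(S,T) = μ{S ↮ T}`, `Xz = X ∪ {z}` etc.):
`K(Xz,T₁)K(Xu,T₂) + K(X,T₁)K(Xzu,T₂) ≤ K(Xz,T₂)K(Xu,T₁) + K(X,T₂)K(Xzu,T₁)`,
i.e. the mixed Bernstein coefficient `g₁ = [K(Xz,T₂)K(Xu,T₁) − K(Xz,T₁)K(Xu,T₂)] + [K(X,T₂)K(Xzu,T₁) − K(X,T₁)K(Xzu,T₂)]` of the
reverse-regularity gap along the source edge `x'z` is nonnegative (no side conditions; the first bracket alone has both signs).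
Certificate: `K(Xu,T₁)K(Xzu,T₁)·g₁ = K(Xu,T₁)²·H₂ + K(Xzu,T₁)²·H₁ + [K(X,T₁)K(Xzu,T₁) − K(Xz,T₁)K(Xu,T₁)]·H₄` with three
reverse-regularity gaps `H₁, H₂, H₄ ≥ 0` (`Consts.disconnect_rr2`) and the log-supermodularity bracket `≥ 0`
(`Consts.real_avoid_insert_mul_le`).
[cite: VandenbergHaggstromKahn2005, Thm. 1.3 (p. 6), Thm. 1.5 (p. 7)] -/
theorem rr2_edgeBernstein (w : Sym2 V → unitInterval) (X : Set V) (z u : V) {T₁ T₂ : Set V} (hT : T₁ ⊆ T₂) :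
    (prodBernoulli w).real {ω : BondConfig V | ∀ s ∈ insert z X, ∀ t ∈ T₁, ¬ (openGraph ω).Reachable s t} *
          (prodBernoulli w).real {ω : BondConfig V | ∀ s ∈ insert u X, ∀ t ∈ T₂, ¬ (openGraph ω).Reachable s t} +
        (prodBernoulli w).real {ω : BondConfig V | ∀ s ∈ X, ∀ t ∈ T₁, ¬ (openGraph ω).Reachable s t} *
          (prodBernoulli w).real {ω : BondConfig V | ∀ s ∈ insert u (insert z X), ∀ t ∈ T₂,
            ¬ (openGraph ω).Reachable s t} ≤
      (prodBernoulli w).real {ω : BondConfig V | ∀ s ∈ insert z X, ∀ t ∈ T₂, ¬ (openGraph ω).Reachable s t} *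
          (prodBernoulli w).real {ω : BondConfig V | ∀ s ∈ insert u X, ∀ t ∈ T₁, ¬ (openGraph ω).Reachable s t} +
        (prodBernoulli w).real {ω : BondConfig V | ∀ s ∈ X, ∀ t ∈ T₂, ¬ (openGraph ω).Reachable s t} *
          (prodBernoulli w).real {ω : BondConfig V | ∀ s ∈ insert u (insert z X), ∀ t ∈ T₁,
            ¬ (openGraph ω).Reachable s t} := by
  classical
  set μ := prodBernoulli w with hμ
  -- the eight kernel values: `a_S = K(S,T₁)`, `b_S = K(S,T₂)` for `S ∈ {X, Xz, Xu, Xzu}`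
  set a0 := μ.real {ω : BondConfig V | ∀ s ∈ X, ∀ t ∈ T₁, ¬ (openGraph ω).Reachable s t} with ha0
  set az := μ.real {ω : BondConfig V | ∀ s ∈ insert z X, ∀ t ∈ T₁, ¬ (openGraph ω).Reachable s t} with haz
  set au := μ.real {ω : BondConfig V | ∀ s ∈ insert u X, ∀ t ∈ T₁, ¬ (openGraph ω).Reachable s t} with hau
  set azu := μ.real {ω : BondConfig V | ∀ s ∈ insert u (insert z X), ∀ t ∈ T₁, ¬ (openGraph ω).Reachable s t}
    with hazu
  set b0 := μ.real {ω : BondConfig V | ∀ s ∈ X, ∀ t ∈ T₂, ¬ (openGraph ω).Reachable s t} with hb0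
  set bz := μ.real {ω : BondConfig V | ∀ s ∈ insert z X, ∀ t ∈ T₂, ¬ (openGraph ω).Reachable s t} with hbz
  set bu := μ.real {ω : BondConfig V | ∀ s ∈ insert u X, ∀ t ∈ T₂, ¬ (openGraph ω).Reachable s t} with hbu
  set bzu := μ.real {ω : BondConfig V | ∀ s ∈ insert u (insert z X), ∀ t ∈ T₂, ¬ (openGraph ω).Reachable s t}
    with hbzu
  -- inclusions of source sets
  have hXu : X ⊆ insert u X := subset_insert _ _
  have hXz : X ⊆ insert z X := subset_insert _ _
  have hXzu : insert z X ⊆ insert u (insert z X) := subset_insert _ _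
  have hXuzu : insert u X ⊆ insert u (insert z X) := insert_subset_insert hXz
  have hX_zu : X ⊆ insert u (insert z X) := hXz.trans hXzu
  -- reverse-regularity gaps (vdBHK Thm 1.5)
  have H1 : a0 * bu ≤ b0 * au := disconnect_rr2 w hXu hT
  have H2 : az * bzu ≤ bz * azu := disconnect_rr2 w hXzu hT
  have H3 : a0 * bzu ≤ b0 * azu := disconnect_rr2 w hX_zu hT
  have H4 : au * bzu ≤ bu * azu := disconnect_rr2 w hXuzu hT
  -- log-supermodularity in the source
  have LS : az * au ≤ a0 * azu := real_avoid_insert_mul_le w X T₁ z u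
  -- monotonicity in the target and nonnegativity
  have mono : ∀ S : Set V, μ.real {ω : BondConfig V | ∀ s ∈ S, ∀ t ∈ T₂, ¬ (openGraph ω).Reachable s t} ≤
      μ.real {ω : BondConfig V | ∀ s ∈ S, ∀ t ∈ T₁, ¬ (openGraph ω).Reachable s t} :=
    fun S => measureReal_mono (fun ω h s hs t ht => h s hs t (hT ht))
  have mz : bz ≤ az := mono _
  have mu : bu ≤ au := mono _
  have mzu : bzu ≤ azu := mono _
  have naz : 0 ≤ az := measureReal_nonneg
  have nau : 0 ≤ au := measureReal_nonneg
  have nazu : 0 ≤ azu := measureReal_nonneg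
  have nbz : 0 ≤ bz := measureReal_nonneg
  have nbu : 0 ≤ bu := measureReal_nonneg
  have nbzu : 0 ≤ bzu := measureReal_nonneg
  -- the certificate
  have hid : au * azu * (bz * au + b0 * azu - az * bu - a0 * bzu) =
      au ^ 2 * (bz * azu - az * bzu) + azu ^ 2 * (b0 * au - a0 * bu) + (a0 * azu - az * au) * (bu * azu - au * bzu) := by
    ring
  have hmain : 0 ≤ au * azu * (bz * au + b0 * azu - az * bu - a0 * bzu) := by
    rw [hid]
    have t1 : 0 ≤ au ^ 2 * (bz * azu - az * bzu) := mul_nonneg (sq_nonneg _) (by linarith)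
    have t2 : 0 ≤ azu ^ 2 * (b0 * au - a0 * bu) := mul_nonneg (sq_nonneg _) (by linarith)
    have t3 : 0 ≤ (a0 * azu - az * au) * (bu * azu - au * bzu) := mul_nonneg (by linarith) (by linarith)
    linarith
  -- conclude: divide by `au * azu > 0`, or settle the degenerate cases
  rcases nau.eq_or_lt with hau0 | haupos
  · -- `au = 0`: then `bu = 0` and the claim is the gap `H3`
    have hbu0 : bu = 0 := le_antisymm (by linarith) nbu
    rw [← hau0, hbu0]; nlinarith [H3]
  rcases nazu.eq_or_lt with hazu0 | hazupos
  · -- `azu = 0`: then `bzu = 0`, and `az * au ≤ 0` forces `az = 0`, hence `bz = 0`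
    have hbzu0 : bzu = 0 := le_antisymm (by linarith) nbzu
    have haz0 : az = 0 := by
      have h1 : az * au ≤ 0 := by rw [← hazu0, mul_zero] at LS; exact LS
      have h2 : az ≤ 0 := by
        by_contra hc
        push Not at hc
        have := mul_pos hc haupos
        linarith
      exact le_antisymm h2 naz
    have hbz0 : bz = 0 := le_antisymm (by linarith) nbz
    rw [← hazu0, hbzu0, haz0, hbz0]; nlinarith
  have hpos : 0 < au * azu := mul_pos haupos hazupos
  have hP : 0 ≤ bz * au + b0 * azu - az * bu - a0 * bzu := by
    by_contra hc
    push Not at hc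
    have := mul_neg_of_pos_of_neg hpos hc
    linarith
  linarith


/-- **THEOREM — the reverse-regularity gap is REAL-ROOTED along every source edge.**  With `a_S = K(S,T₁)`, `b_S = K(S,T₂)`
(`T₁ ⊆ T₂`), the Bernstein coefficients `g₀ = b(X)a(Xu) − a(X)b(Xu)`, `g₂ = b(Xz)a(Xzu) − a(Xz)b(Xzu)` and the mixed coefficient `g₁` of
`Consts.rr2_edgeBernstein` satisfy `g₁² ≥ 4·g₀·g₂`, i.e. `g₁ ≥ 2√(g₀g₂)`: the quadratic `t ↦ g(X_t) = g₀(1−t)² + g₁t(1−t) + g₂t²` (the gap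
along the interpolation `K_t(S,T) = (1−t)K(S,T) + tK(S∪z,T)` of a source edge) has only real roots, none in `(0,1)`, and
`√g` is affinely minorised: `g(X_t) ≥ ((1−t)√g₀ + t√g₂)²`.  From the certificate of `Consts.rr2_edgeBernstein`
(`a(Xu)a(Xzu)·g₁ ≥ a(Xu)²g₂ + a(Xzu)²g₀`) and `(a(Xu)²g₂ + a(Xzu)²g₀)² ≥ 4a(Xu)²a(Xzu)²g₀g₂`.
[cite: VandenbergHaggstromKahn2005, Thm. 1.3 (p. 6), Thm. 1.5 (p. 7)] -/
theorem rr2_edge_realRooted (w : Sym2 V → unitInterval) (X : Set V) (z u : V) {T₁ T₂ : Set V} (hT : T₁ ⊆ T₂) :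
    4 * ((prodBernoulli w).real {ω : BondConfig V | ∀ s ∈ X, ∀ t ∈ T₂, ¬ (openGraph ω).Reachable s t} *
            (prodBernoulli w).real {ω : BondConfig V | ∀ s ∈ insert u X, ∀ t ∈ T₁, ¬ (openGraph ω).Reachable s t} -
          (prodBernoulli w).real {ω : BondConfig V | ∀ s ∈ X, ∀ t ∈ T₁, ¬ (openGraph ω).Reachable s t} *
            (prodBernoulli w).real {ω : BondConfig V | ∀ s ∈ insert u X, ∀ t ∈ T₂, ¬ (openGraph ω).Reachable s t}) *
        ((prodBernoulli w).real {ω : BondConfig V | ∀ s ∈ insert z X, ∀ t ∈ T₂, ¬ (openGraph ω).Reachable s t} *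
            (prodBernoulli w).real {ω : BondConfig V | ∀ s ∈ insert u (insert z X), ∀ t ∈ T₁,
              ¬ (openGraph ω).Reachable s t} -
          (prodBernoulli w).real {ω : BondConfig V | ∀ s ∈ insert z X, ∀ t ∈ T₁, ¬ (openGraph ω).Reachable s t} *
            (prodBernoulli w).real {ω : BondConfig V | ∀ s ∈ insert u (insert z X), ∀ t ∈ T₂,
              ¬ (openGraph ω).Reachable s t}) ≤
      ((prodBernoulli w).real {ω : BondConfig V | ∀ s ∈ insert z X, ∀ t ∈ T₂, ¬ (openGraph ω).Reachable s t} *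
            (prodBernoulli w).real {ω : BondConfig V | ∀ s ∈ insert u X, ∀ t ∈ T₁, ¬ (openGraph ω).Reachable s t} -
          (prodBernoulli w).real {ω : BondConfig V | ∀ s ∈ insert z X, ∀ t ∈ T₁, ¬ (openGraph ω).Reachable s t} *
            (prodBernoulli w).real {ω : BondConfig V | ∀ s ∈ insert u X, ∀ t ∈ T₂, ¬ (openGraph ω).Reachable s t} +
        ((prodBernoulli w).real {ω : BondConfig V | ∀ s ∈ X, ∀ t ∈ T₂, ¬ (openGraph ω).Reachable s t} *
            (prodBernoulli w).real {ω : BondConfig V | ∀ s ∈ insert u (insert z X), ∀ t ∈ T₁,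
              ¬ (openGraph ω).Reachable s t} -
          (prodBernoulli w).real {ω : BondConfig V | ∀ s ∈ X, ∀ t ∈ T₁, ¬ (openGraph ω).Reachable s t} *
            (prodBernoulli w).real {ω : BondConfig V | ∀ s ∈ insert u (insert z X), ∀ t ∈ T₂,
              ¬ (openGraph ω).Reachable s t})) ^ 2 := by
  classical
  set μ := prodBernoulli w with hμ
  set a0 := μ.real {ω : BondConfig V | ∀ s ∈ X, ∀ t ∈ T₁, ¬ (openGraph ω).Reachable s t} with ha0
  set az := μ.real {ω : BondConfig V | ∀ s ∈ insert z X, ∀ t ∈ T₁, ¬ (openGraph ω).Reachable s t} with haz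
  set au := μ.real {ω : BondConfig V | ∀ s ∈ insert u X, ∀ t ∈ T₁, ¬ (openGraph ω).Reachable s t} with hau
  set azu := μ.real {ω : BondConfig V | ∀ s ∈ insert u (insert z X), ∀ t ∈ T₁, ¬ (openGraph ω).Reachable s t}
    with hazu
  set b0 := μ.real {ω : BondConfig V | ∀ s ∈ X, ∀ t ∈ T₂, ¬ (openGraph ω).Reachable s t} with hb0
  set bz := μ.real {ω : BondConfig V | ∀ s ∈ insert z X, ∀ t ∈ T₂, ¬ (openGraph ω).Reachable s t} with hbz
  set bu := μ.real {ω : BondConfig V | ∀ s ∈ insert u X, ∀ t ∈ T₂, ¬ (openGraph ω).Reachable s t} with hbu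
  set bzu := μ.real {ω : BondConfig V | ∀ s ∈ insert u (insert z X), ∀ t ∈ T₂, ¬ (openGraph ω).Reachable s t}
    with hbzu
  have hXu : X ⊆ insert u X := subset_insert _ _
  have hXz : X ⊆ insert z X := subset_insert _ _
  have hXzu : insert z X ⊆ insert u (insert z X) := subset_insert _ _
  have hXuzu : insert u X ⊆ insert u (insert z X) := insert_subset_insert hXz
  have H1 : a0 * bu ≤ b0 * au := disconnect_rr2 w hXu hT
  have H2 : az * bzu ≤ bz * azu := disconnect_rr2 w hXzu hT
  have H4 : au * bzu ≤ bu * azu := disconnect_rr2 w hXuzu hT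
  have LS : az * au ≤ a0 * azu := real_avoid_insert_mul_le w X T₁ z u
  have mono : ∀ S : Set V, μ.real {ω : BondConfig V | ∀ s ∈ S, ∀ t ∈ T₂, ¬ (openGraph ω).Reachable s t} ≤
      μ.real {ω : BondConfig V | ∀ s ∈ S, ∀ t ∈ T₁, ¬ (openGraph ω).Reachable s t} :=
    fun S => measureReal_mono (fun ω h s hs t ht => h s hs t (hT ht))
  have mu : bu ≤ au := mono _
  have mzu : bzu ≤ azu := mono _
  have nau : 0 ≤ au := measureReal_nonneg
  have nazu : 0 ≤ azu := measureReal_nonneg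
  have nbu : 0 ≤ bu := measureReal_nonneg
  have nbzu : 0 ≤ bzu := measureReal_nonneg
  -- the certificate of `rr2_edgeBernstein` and the two squares
  set g0 := b0 * au - a0 * bu with hg0
  set g2 := bz * azu - az * bzu with hg2
  set g1 := bz * au - az * bu + (b0 * azu - a0 * bzu) with hg1
  have hid : au * azu * g1 = au ^ 2 * g2 + azu ^ 2 * g0 + (a0 * azu - az * au) * (bu * azu - au * bzu) := by
    simp only [hg0, hg1, hg2]; ring
  have hg0n : 0 ≤ g0 := by rw [hg0]; linarith
  have hg2n : 0 ≤ g2 := by rw [hg2]; linarith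
  have hW : au ^ 2 * g2 + azu ^ 2 * g0 ≤ au * azu * g1 := by
    rw [hid]; exact le_add_of_nonneg_right (mul_nonneg (sub_nonneg.2 LS) (sub_nonneg.2 H4))
  have hWn : 0 ≤ au ^ 2 * g2 + azu ^ 2 * g0 := by positivity
  -- `(au·azu·g1)² ≥ (au²g2 + azu²g0)² ≥ 4 au² azu² g0 g2`
  have h1 : (au ^ 2 * g2 + azu ^ 2 * g0) ^ 2 ≤ (au * azu * g1) ^ 2 := pow_le_pow_left₀ hWn hW 2
  have h2 : 4 * (au ^ 2 * azu ^ 2) * (g0 * g2) ≤ (au ^ 2 * g2 + azu ^ 2 * g0) ^ 2 := by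
    have h := sq_nonneg (au ^ 2 * g2 - azu ^ 2 * g0)
    have e : (au ^ 2 * g2 + azu ^ 2 * g0) ^ 2 - 4 * (au ^ 2 * azu ^ 2) * (g0 * g2) =
        (au ^ 2 * g2 - azu ^ 2 * g0) ^ 2 := by ring
    linarith [h, e]
  have key : (au ^ 2 * azu ^ 2) * (4 * g0 * g2) ≤ (au ^ 2 * azu ^ 2) * g1 ^ 2 := by
    calc (au ^ 2 * azu ^ 2) * (4 * g0 * g2) = 4 * (au ^ 2 * azu ^ 2) * (g0 * g2) := by ring
      _ ≤ (au * azu * g1) ^ 2 := h2.trans h1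
      _ = (au ^ 2 * azu ^ 2) * g1 ^ 2 := by ring
  show 4 * g0 * g2 ≤ g1 ^ 2
  rcases nau.eq_or_lt with hau0 | haupos
  · -- `au = 0`: then `bu = 0`, `g0 = 0`
    have hbu0 : bu = 0 := le_antisymm (by linarith) nbu
    have hz : g0 = 0 := by rw [hg0, ← hau0, hbu0]; ring
    rw [hz, mul_zero, zero_mul]; exact sq_nonneg g1
  rcases nazu.eq_or_lt with hazu0 | hazupos
  · have hbzu0 : bzu = 0 := le_antisymm (by linarith) nbzu
    have hz : g2 = 0 := by rw [hg2, ← hazu0, hbzu0]; ring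
    rw [hz, mul_zero]; exact sq_nonneg g1
  have hpos : 0 < au ^ 2 * azu ^ 2 := by positivity
  exact le_of_mul_le_mul_left key hpos

end Consts

end Summit.CriticalPhenomena.PercolationContinuityZ3.Theorems

end
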